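import Summits.QuantumFields.YangMills.Theorems.FluctuationComparisonRegPrIntLWregGlue
import HarnessLib

/-!
# `FluctuationComparisonRegPrIntLHaarTubeLscFloor` — THE L.S.C.-FLOOR ENGINE FOR ⟨HAAR-TUBE₁⟩'S FIBREWISE LETTER: lower semicontinuity of parametric
# lower integrals, a uniform positive floor on compact sets, and the window-chart instance (crux `FluctuationComparisonRegPrIntL`,
# stmt-QuantumFields-20520; LINE g22-4 ∕ g22-5, row TUBE∘ after LEAD w3-20520 g18's TUBE∘-SPLIT and px8 g14's door `…HaarTubeOneStep`)

Cell `ym3-torus` (YM ladder rung R3 = continuum SU(2) Yang–Mills on T³ — a RUNG, NOT d = 4, NOT infinite volume, NOT a mass gap, NOT Clay);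
width seat `ym-ust-20520-w4` (gen 18), explicit-unit helper; `--supports stmt-QuantumFields-20520 --as helper`.  THEOREMS ONLY (0 `def`, 0 `sorry`,
default heartbeats).

WHAT.  After px8 g14's door (`haarTube_oneStep_of_windowCharts`) the ⟨HAAR-TUBE₁⟩ residue is ONE fibrewise letter per window chart `c : WindowChart F hJK Sfine O`:
«for `dU_J`-a.e. `U ∈ O ∩ W`, `ofReal q·∫⁻ c.jac(U,z) dU_K(z) ≤ ∫⁻ 1_{tube_r(σ U)}(c.Φ(U,z))·c.jac(U,z) dU_K(z)`» with ONE `q` for the whole window and a merely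
measurable section `σ`.  Since `σ` has no continuity, the infimum must run over ALL admissible centres `x` of the tube, and the letter splits into
(α) a GENERIC ENGINE — this file — and (β) the chart-level POINTWISE charge of every tube (left to the chart hands, displayed below as the hypothesis `hpos`):
* §1 ★★ `lowerSemicontinuousAt_lintegral` — GENERIC (first-countable `X`, any measure space `(Z, τ)`): if every leaf `g x` is a.e.-measurable and for `τ`-a.e. `z`
  the map `x ↦ g x z` is lower semicontinuous at `x₀`, then `x ↦ ∫⁻ g x z ∂τ` is lower semicontinuous at `x₀` (Fatou along `𝓝 x₀`, ✓`lintegral_liminf_le'`);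
  `lowerSemicontinuousOn_lintegral` (the `On` form).
* §2 ★ `exists_pos_le_of_lowerSemicontinuousOn` ∕ `exists_ofReal_le_of_lowerSemicontinuousOn` — a positive l.s.c. `ℝ≥0∞`-function on a compact set has a uniform
  positive floor (✓`LowerSemicontinuousOn.exists_isMinOn`).
* §3 ★ `lowerSemicontinuousAt_indicator_comp_mul` — GENERIC: `x ↦ 1_G(φ x)·h x` is l.s.c. at `x₀` when `φ` is continuous at `x₀`, `h` is l.s.c. at `x₀`, and
  `G` is a neighbourhood of `φ x₀` whenever it contains it; `isOpen_setOf_linkClose` — the link-tube relation `{(x, V) | ∀ b, dist1 ((x b)⁻¹·V b) < r}` is OPEN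
  jointly in (centre, point).
* §4 ★★★ THE CHART INSTANCE from `c.regular` ALONE: `ae_lowerSemicontinuousAt_tubeIntegrand` — for `U₀ ∈ O` and any centre `x₀`, for `dU_K`-a.e. `z` the integrand
  `(U, x) ↦ 1_{Sfine ∩ tube_r(x)}(c.Φ(U,z))·c.jac(U,z)` is l.s.c. at `(U₀, x₀)`; ★★★ `lowerSemicontinuousOn_tubeCharge` — the TUBE CHARGE
  `G(U, x) := ∫⁻ 1_{Sfine ∩ tube_r(x)}(c.Φ(U,z))·c.jac(U,z) dU_K(z)` is l.s.c. on `O ×ˢ univ`.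
* §5 ★★★ `exists_floor_tubeCharge_of_pos` — on ANY compact pair set `P ⊆ O ×ˢ univ` on which every tube is charged (`hpos : ∀ p ∈ P, 0 < G p`) there is ONE
  `q > 0` with `ofReal q·∫⁻ c.jac(U,z) ≤ ∫⁻ 1_{tube_r(x)}(c.Φ(U,z))·c.jac(U,z)` for every `(U, x) ∈ P` (`∫⁻ jac ≤ c.bound`, Haar a probability measure);
  ★★★ `hfib_of_pos` — hence px8 g14's `hfib` letter VERBATIM (a.e. on `O ∩ W`) for any section `σ` with `(U, σ U) ∈ P` on `O ∩ W`.
* §6 (v1.1) FEEDERS + POINT-CHARGE DOOR: `pos_tubeCharge_of_measure_pos` (positive Haar mass of the live set `{jac ≠ 0 ∧ Φ ∈ Sfine ∩ tube}` ⟹ positive charge),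
  `isCompact_graph_image` ∕ `graph_image_subset_prod` ∕ `mem_graph_image` (the pair set `(D, id) '' C`), ★★★ `hfib_of_pointCharge` — px8's `hfib` from: `C` compact,
  `D` continuous ON `C`, `D '' C ⊆ O`, the `r`-tube around EVERY `x ∈ C` charged in the chart over `D x`, and `σ U ∈ C`, `D (σ U) = U` on `O ∩ W`.
So ⟨HAAR-TUBE₁⟩'s letter on a chart ⟸ {pointwise tube charge on a compact admissible pair set} — the compactness∕finite-cover bookkeeping and the pointwise
charge ([Balaban1985Averaging] Prop. 1: the one-step averaging is a submersion on regular configurations, so the conditional Haar law charges every ball of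
the fibre) are NOT proved here.

HONEST SCOPE.  Measure-theoretic∕topological plumbing over landed objects; nothing of Bałaban's asserted; the pointwise charge, ⟨HAAR-TUBE₁⟩'s letter, ⟨UP⟩,
⟨LOW⟩, TUBE∘, PERS₁∘, PLAQTAIL∘, LFR♯ᶜ∘, S2β, the crux 20520 and every rung statement are NOT proved; `YM3TorusSU2` NOT proved; the Yang–Mills mass gap (Clay)
NOT proved.

References: T. Bałaban, Commun. Math. Phys. **98** (1985) 17–51 [Balaban1985Averaging] ((10) p. 19, Prop. 1 p. 22); CMP **109** (1987) 249–301
[Balaban1987RG1] ((0.4) p. 253, (0.13) p. 254, (2.10) p. 267); CMP **102** (1985) 255–275 [Balaban1985UV3] ((7) p. 257).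
-/

set_option autoImplicit false

noncomputable section

open MeasureTheory Filter Topology Set
open scoped ENNReal NNReal
open Literature.MathematicalPhysics.QuantumFieldTheory.Balaban1983to89
open Literature.MathematicalPhysics.QuantumFieldTheory.Balaban1983to89.T3ContinuumYM3Torus
open Literature.MathematicalPhysics.QuantumFieldTheory.Balaban1983to89.T3UnitLawDensityEML
open Literature.MathematicalPhysics.QuantumFieldTheory.Balaban1983to89.T3TiltDescent
open scoped Literature.MathematicalPhysics.QuantumFieldTheory.Balaban1983to89.T3OrbitAverage
open Summit.QuantumFields.YangMills.Theorems.FluctuationComparisonRegPrIntLWregGlue (WindowChart)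

namespace Summit.QuantumFields.YangMills.Theorems.FluctuationComparisonRegPrIntLHaarTubeLscFloor

/-! ## §1 Generic: lower semicontinuity of parametric lower integrals (Fatou along `𝓝 x₀`) -/

section Lsc

variable {X Z : Type*} [TopologicalSpace X] [MeasurableSpace Z] {τ : Measure Z} {g : X → Z → ℝ≥0∞}

/-- ★★ **A PARAMETRIC LOWER INTEGRAL IS LOWER SEMICONTINUOUS WHERE ITS LEAVES ARE, a.e.** (first-countable parameter space): if every leaf `g x` is
a.e.-measurable and for `τ`-a.e. `z` the map `x ↦ g x z` is lower semicontinuous at `x₀`, then `x ↦ ∫⁻ g x z ∂τ` is lower semicontinuous at `x₀`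
(`f x₀ ≤ ∫⁻ liminf ≤ liminf ∫⁻`, Fatou ✓`lintegral_liminf_le'` along the countably generated filter `𝓝 x₀`). [folklore] -/
theorem lowerSemicontinuousAt_lintegral [FirstCountableTopology X] {x₀ : X}
    (hmeas : ∀ x, AEMeasurable (g x) τ) (hlsc : ∀ᵐ z ∂τ, LowerSemicontinuousAt (fun x => g x z) x₀) :
    LowerSemicontinuousAt (fun x => ∫⁻ z, g x z ∂τ) x₀ := by
  rw [lowerSemicontinuousAt_iff_le_liminf]
  haveI : (𝓝 x₀).IsCountablyGenerated := FirstCountableTopology.nhds_generated_countable x₀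
  calc ∫⁻ z, g x₀ z ∂τ ≤ ∫⁻ z, liminf (fun x => g x z) (𝓝 x₀) ∂τ :=
        lintegral_mono_ae (hlsc.mono fun z hz => hz.le_liminf)
    _ ≤ liminf (fun x => ∫⁻ z, g x z ∂τ) (𝓝 x₀) := lintegral_liminf_le' hmeas

/-- **The `On` form**: l.s.c. on `s` of `x ↦ ∫⁻ g x z ∂τ` from a.e.-leafwise l.s.c. at every `x₀ ∈ s`. [folklore] -/
theorem lowerSemicontinuousOn_lintegral [FirstCountableTopology X] {s : Set X}
    (hmeas : ∀ x, AEMeasurable (g x) τ) (hlsc : ∀ x₀ ∈ s, ∀ᵐ z ∂τ, LowerSemicontinuousAt (fun x => g x z) x₀) :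
    LowerSemicontinuousOn (fun x => ∫⁻ z, g x z ∂τ) s :=
  fun x₀ hx₀ => (lowerSemicontinuousAt_lintegral hmeas (hlsc x₀ hx₀)).lowerSemicontinuousWithinAt s

end Lsc

/-! ## §2 Generic: a positive l.s.c. function on a compact set has a uniform positive floor -/

section Floor

variable {X : Type*} [TopologicalSpace X] {K : Set X} {f : X → ℝ≥0∞}

/-- ★ **UNIFORM FLOOR**: on a compact `K`, an `ℝ≥0∞`-valued function l.s.c. on `K` and positive on `K` is bounded below on `K` by ONE `m > 0`
(the minimum is attained, ✓`LowerSemicontinuousOn.exists_isMinOn`; `K = ∅` gives `m = 1`). [folklore] -/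
theorem exists_pos_le_of_lowerSemicontinuousOn (hK : IsCompact K) (hf : LowerSemicontinuousOn f K) (hpos : ∀ x ∈ K, 0 < f x) :
    ∃ m : ℝ≥0∞, 0 < m ∧ ∀ x ∈ K, m ≤ f x := by
  rcases K.eq_empty_or_nonempty with hK0 | hne
  · exact ⟨1, one_pos, fun x hx => by simp [hK0] at hx⟩
  · obtain ⟨a, ha, hmin⟩ := hf.exists_isMinOn hne hK
    exact ⟨f a, hpos a ha, fun x hx => hmin hx⟩

/-- **UNIFORM FLOOR, real currency**: same, with a real `q > 0` and `ENNReal.ofReal q ≤ f x` on `K` (take `min m 1`). [folklore] -/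
theorem exists_ofReal_le_of_lowerSemicontinuousOn (hK : IsCompact K) (hf : LowerSemicontinuousOn f K) (hpos : ∀ x ∈ K, 0 < f x) :
    ∃ q : ℝ, 0 < q ∧ ∀ x ∈ K, ENNReal.ofReal q ≤ f x := by
  obtain ⟨m, hm, hle⟩ := exists_pos_le_of_lowerSemicontinuousOn hK hf hpos
  have hfin : min m 1 ≠ ∞ := ne_top_of_le_ne_top ENNReal.one_ne_top (min_le_right _ _)
  have hpos' : 0 < min m 1 := lt_min hm one_pos
  refine ⟨(min m 1).toReal, ENNReal.toReal_pos hpos'.ne' hfin, fun x hx => ?_⟩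
  rw [ENNReal.ofReal_toReal hfin]
  exact (min_le_left _ _).trans (hle x hx)

end Floor

/-! ## §3 Generic: indicator of a neighbourhood composed with a continuous map, times an l.s.c. factor; the link-tube relation is open -/

section Indicator

variable {X Y : Type*} [TopologicalSpace X] [TopologicalSpace Y]

/-- ★ **`1_G(φ x)·h x` IS L.S.C. AT `x₀`** when `φ` is continuous at `x₀`, `h` is l.s.c. at `x₀`, and `G` is a neighbourhood of `φ x₀` if it contains it
(e.g. `φ x₀ ∉ G ∖ interior G`): off `G` the value is `0`, on `G` the indicator is eventually `1`. [folklore] -/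
theorem lowerSemicontinuousAt_indicator_comp_mul {G : Set Y} {φ : X → Y} {h : X → ℝ≥0∞} {x₀ : X}
    (hG : φ x₀ ∈ G → G ∈ 𝓝 (φ x₀)) (hφ : ContinuousAt φ x₀) (hh : LowerSemicontinuousAt h x₀) :
    LowerSemicontinuousAt (fun x => G.indicator (fun _ => (1 : ℝ≥0∞)) (φ x) * h x) x₀ := by
  intro y hy
  by_cases hx₀ : φ x₀ ∈ G
  · have hev : ∀ᶠ x in 𝓝 x₀, φ x ∈ G := hφ.eventually_mem (hG hx₀)
    have hy' : y < h x₀ := by simpa [Set.indicator_of_mem hx₀] using hy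
    filter_upwards [hev, hh y hy'] with x hxG hxy
    simpa [Set.indicator_of_mem hxG] using hxy
  · simp [Set.indicator_of_notMem hx₀] at hy

variable {P : Params} {j : ℕ}

/-- ★ **THE LINK-TUBE RELATION IS OPEN, JOINTLY IN (CENTRE, POINT)**: `{(x, V) | ∀ b, dist1 ((x b)⁻¹ · V b) < r}` is open in `SU(2)^{bonds} × SU(2)^{bonds}`
(finitely many strict inequalities between continuous functions; `dist1` continuous on `SU(2)`, ✓`continuous_dist1_SU`). [folklore] -/
theorem isOpen_setOf_linkClose (r : ℝ) :
    IsOpen {p : GaugeField P j (Matrix.specialUnitaryGroup (Fin 2) ℂ) × GaugeField P j (Matrix.specialUnitaryGroup (Fin 2) ℂ) |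
      ∀ b : PBond P j, dist1 ((p.1 b)⁻¹ * p.2 b) < r} := by
  simp only [Set.setOf_forall]
  refine isOpen_iInter_of_finite fun b => isOpen_lt ?_ continuous_const
  have h1 : Continuous fun p : GaugeField P j (Matrix.specialUnitaryGroup (Fin 2) ℂ) × GaugeField P j (Matrix.specialUnitaryGroup (Fin 2) ℂ) => p.1 b :=
    (show Continuous fun U : GaugeField P j (Matrix.specialUnitaryGroup (Fin 2) ℂ) => U b from continuous_apply b).comp continuous_fst
  have h2 : Continuous fun p : GaugeField P j (Matrix.specialUnitaryGroup (Fin 2) ℂ) × GaugeField P j (Matrix.specialUnitaryGroup (Fin 2) ℂ) => p.2 b :=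
    (show Continuous fun U : GaugeField P j (Matrix.specialUnitaryGroup (Fin 2) ℂ) => U b from continuous_apply b).comp continuous_snd
  exact (B12ContinuousTransportInvarianceOn.continuous_dist1_SU (N := 2)).comp (h1.inv.mul h2)

/-- **Each link-tube `{V | ∀ b, dist1 ((x b)⁻¹ · V b) < r}` is open** (the slice of the open relation at a centre `x`). [folklore] -/
theorem isOpen_linkTube (x : GaugeField P j (Matrix.specialUnitaryGroup (Fin 2) ℂ)) (r : ℝ) :
    IsOpen {V : GaugeField P j (Matrix.specialUnitaryGroup (Fin 2) ℂ) | ∀ b : PBond P j, dist1 ((x b)⁻¹ * V b) < r} :=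
  (isOpen_setOf_linkClose (P := P) (j := j) r).preimage (Continuous.prodMk_right x)

end Indicator

/-! ## §4 The window-chart instance: the tube charge is lower semicontinuous on `O × univ`, from `c.regular` alone -/

section Chart

variable (F : T3Family) {J K : ℕ} (hJK : J ≤ K)
  {Sfine : Set (GaugeField (F.P K) 0 (Matrix.specialUnitaryGroup (Fin 2) ℂ))}
  {O : Set (GaugeField (F.P J) 0 (Matrix.specialUnitaryGroup (Fin 2) ℂ))}

/-- ★★★ **A.E.-LEAFWISE L.S.C. OF THE TUBE INTEGRAND** (from the chart's `regular` field alone): for a window chart `c`, `U₀ ∈ O` and ANY centre `x₀`, for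
`dU_K`-a.e. `z` the map `(U, x) ↦ 1_{Sfine ∩ tube_r(x)}(c.Φ(U,z))·c.jac(U,z)` is lower semicontinuous at `(U₀, x₀)`.  Cases of `c.regular U₀`: on the regular
branch with `c.jac(U₀,z) ≠ 0` the leaf point `c.Φ(U₀,z)` is off `frontier Sfine`, so if the integrand is non-zero at `(U₀,x₀)` then `c.Φ(U₀,z) ∈ interior Sfine`
and the tube relation is open (§3) — the indicator is eventually `1` and `c.jac(·,z)` is continuous; in every other case the value at `(U₀,x₀)` is `0`.
[cite: Balaban1987RG1, (0.13) p.254 (bookkeeping); Balaban1985Averaging, (10) p.19] -/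
theorem ae_lowerSemicontinuousAt_tubeIntegrand (c : WindowChart F hJK Sfine O) {U₀ : GaugeField (F.P J) 0 (Matrix.specialUnitaryGroup (Fin 2) ℂ)}
    (hU₀ : U₀ ∈ O) (x₀ : GaugeField (F.P K) 0 (Matrix.specialUnitaryGroup (Fin 2) ℂ)) (r : ℝ) :
    ∀ᵐ z ∂(fieldMeasure (F.P K) 0 (Matrix.specialUnitaryGroup (Fin 2) ℂ)),
      LowerSemicontinuousAt (fun p : GaugeField (F.P J) 0 (Matrix.specialUnitaryGroup (Fin 2) ℂ) × GaugeField (F.P K) 0 (Matrix.specialUnitaryGroup (Fin 2) ℂ) =>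
        (Sfine ∩ {V : GaugeField (F.P K) 0 (Matrix.specialUnitaryGroup (Fin 2) ℂ) | ∀ b : PBond (F.P K) 0, dist1 ((p.2 b)⁻¹ * V b) < r}).indicator
            (fun _ => (1 : ℝ≥0∞)) (c.Φ (p.1, z)) * (c.jac (p.1, z) : ℝ≥0∞)) (U₀, x₀) := by
  filter_upwards [c.regular U₀ hU₀] with z hz
  -- the trivial case: value `0` at `(U₀, x₀)`
  have triv : (Sfine ∩ {V : GaugeField (F.P K) 0 (Matrix.specialUnitaryGroup (Fin 2) ℂ) | ∀ b : PBond (F.P K) 0, dist1 ((x₀ b)⁻¹ * V b) < r}).indicator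
        (fun _ => (1 : ℝ≥0∞)) (c.Φ (U₀, z)) * (c.jac (U₀, z) : ℝ≥0∞) = 0 →
      LowerSemicontinuousAt (fun p : GaugeField (F.P J) 0 (Matrix.specialUnitaryGroup (Fin 2) ℂ) × GaugeField (F.P K) 0 (Matrix.specialUnitaryGroup (Fin 2) ℂ) =>
        (Sfine ∩ {V : GaugeField (F.P K) 0 (Matrix.specialUnitaryGroup (Fin 2) ℂ) | ∀ b : PBond (F.P K) 0, dist1 ((p.2 b)⁻¹ * V b) < r}).indicator
            (fun _ => (1 : ℝ≥0∞)) (c.Φ (p.1, z)) * (c.jac (p.1, z) : ℝ≥0∞)) (U₀, x₀) := by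
    intro h0 y hy
    exact absurd (hy.trans_le (le_of_eq h0)) ENNReal.not_lt_zero
  rcases hz with ⟨hj, hΦ, hfr⟩ | hev
  · by_cases h0 : c.jac (U₀, z) = 0
    · exact triv (by simp [h0])
    · -- regular branch, `jac ≠ 0`: use §3 with `φ p := (p.2, c.Φ (p.1, z))` and the open relation `interior Sfine`-slice
      -- rewrite the integrand as an indicator of a set of pairs (centre, point)
      have hset : ∀ p : GaugeField (F.P J) 0 (Matrix.specialUnitaryGroup (Fin 2) ℂ) × GaugeField (F.P K) 0 (Matrix.specialUnitaryGroup (Fin 2) ℂ),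
          (Sfine ∩ {V : GaugeField (F.P K) 0 (Matrix.specialUnitaryGroup (Fin 2) ℂ) | ∀ b : PBond (F.P K) 0, dist1 ((p.2 b)⁻¹ * V b) < r}).indicator
              (fun _ => (1 : ℝ≥0∞)) (c.Φ (p.1, z)) =
            {w : GaugeField (F.P K) 0 (Matrix.specialUnitaryGroup (Fin 2) ℂ) × GaugeField (F.P K) 0 (Matrix.specialUnitaryGroup (Fin 2) ℂ) |
                w.2 ∈ Sfine ∧ ∀ b : PBond (F.P K) 0, dist1 ((w.1 b)⁻¹ * w.2 b) < r}.indicator (fun _ => (1 : ℝ≥0∞)) (p.2, c.Φ (p.1, z)) := by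
        intro p
        by_cases hp : c.Φ (p.1, z) ∈ Sfine ∩ {V : GaugeField (F.P K) 0 (Matrix.specialUnitaryGroup (Fin 2) ℂ) | ∀ b : PBond (F.P K) 0, dist1 ((p.2 b)⁻¹ * V b) < r}
        · rw [Set.indicator_of_mem hp, Set.indicator_of_mem (by exact hp)]
        · rw [Set.indicator_of_notMem hp, Set.indicator_of_notMem (by exact hp)]
      simp_rw [hset]
      refine lowerSemicontinuousAt_indicator_comp_mul ?_ ?_ ?_
      · -- the relation is a neighbourhood of `(x₀, c.Φ (U₀, z))` if it holds there: `c.Φ(U₀,z) ∈ Sfine ∖ frontier Sfine ⊆ interior Sfine`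
        rintro ⟨hS, htube⟩
        have hint : c.Φ (U₀, z) ∈ interior Sfine := by
          have hnf : c.Φ (U₀, z) ∉ frontier Sfine := hfr h0
          rw [← closure_sdiff_frontier Sfine]
          exact ⟨subset_closure hS, hnf⟩
        have hopen : IsOpen {w : GaugeField (F.P K) 0 (Matrix.specialUnitaryGroup (Fin 2) ℂ) × GaugeField (F.P K) 0 (Matrix.specialUnitaryGroup (Fin 2) ℂ) |
            w.2 ∈ interior Sfine ∧ ∀ b : PBond (F.P K) 0, dist1 ((w.1 b)⁻¹ * w.2 b) < r} :=
          (isOpen_interior.preimage continuous_snd).inter (isOpen_setOf_linkClose (P := F.P K) (j := 0) r)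
        refine Filter.mem_of_superset (hopen.mem_nhds ⟨hint, htube⟩) ?_
        rintro w ⟨hw1, hw2⟩
        exact ⟨interior_subset hw1, hw2⟩
      · have hΦ2 : ContinuousAt (fun p : GaugeField (F.P J) 0 (Matrix.specialUnitaryGroup (Fin 2) ℂ) ×
            GaugeField (F.P K) 0 (Matrix.specialUnitaryGroup (Fin 2) ℂ) => c.Φ (p.1, z)) (U₀, x₀) :=
          ContinuousAt.comp (g := fun V => c.Φ (V, z)) (f := Prod.fst) hΦ continuousAt_fst
        exact continuousAt_snd.prodMk hΦ2
      · -- `jac (·, z)` continuous at `U₀` as an `ℝ≥0∞`-valued map of the pair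
        have hj' : ContinuousAt (fun V => c.jac (V, z)) U₀ := NNReal.tendsto_coe.mp hj
        have hj'' : ContinuousAt (fun V => (c.jac (V, z) : ℝ≥0∞)) U₀ := ENNReal.continuous_coe.continuousAt.comp hj'
        have hj2 : ContinuousAt (fun p : GaugeField (F.P J) 0 (Matrix.specialUnitaryGroup (Fin 2) ℂ) ×
            GaugeField (F.P K) 0 (Matrix.specialUnitaryGroup (Fin 2) ℂ) => (c.jac (p.1, z) : ℝ≥0∞)) (U₀, x₀) :=
          ContinuousAt.comp (g := fun V => (c.jac (V, z) : ℝ≥0∞)) (f := Prod.fst) hj'' continuousAt_fst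
        exact (continuousAt_iff_lower_upperSemicontinuousAt.mp hj2).1
  · -- singular branch: eventually (hence at `U₀`) `jac = 0` or `Φ ∉ Sfine` — value `0`
    rcases hev.self_of_nhds with h0 | hnS
    · exact triv (by simp [h0])
    · exact triv (by simp [Set.indicator_of_notMem (fun h : c.Φ (U₀, z) ∈ Sfine ∩ _ => hnS h.1)])

/-- **Measurability of every leaf of the tube integrand** (`Sfine` measurable; the tube is open hence Borel). [folklore] -/
theorem measurable_tubeIntegrand (c : WindowChart F hJK Sfine O) (hS : MeasurableSet Sfine) (r : ℝ)
    (p : GaugeField (F.P J) 0 (Matrix.specialUnitaryGroup (Fin 2) ℂ) × GaugeField (F.P K) 0 (Matrix.specialUnitaryGroup (Fin 2) ℂ)) :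
    Measurable fun z => (Sfine ∩ {V : GaugeField (F.P K) 0 (Matrix.specialUnitaryGroup (Fin 2) ℂ) | ∀ b : PBond (F.P K) 0, dist1 ((p.2 b)⁻¹ * V b) < r}).indicator
        (fun _ => (1 : ℝ≥0∞)) (c.Φ (p.1, z)) * (c.jac (p.1, z) : ℝ≥0∞) := by
  have hΦ : Measurable fun z => c.Φ (p.1, z) := c.measurable_Φ.comp measurable_prodMk_left
  have hT : MeasurableSet (Sfine ∩ {V : GaugeField (F.P K) 0 (Matrix.specialUnitaryGroup (Fin 2) ℂ) | ∀ b : PBond (F.P K) 0, dist1 ((p.2 b)⁻¹ * V b) < r}) :=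
    hS.inter (isOpen_linkTube (P := F.P K) (j := 0) p.2 r).measurableSet
  exact ((measurable_const.indicator hT).comp hΦ).mul
    (measurable_coe_nnreal_ennreal.comp (c.measurable_jac.comp measurable_prodMk_left))

/-- ★★★ **THE TUBE CHARGE IS LOWER SEMICONTINUOUS ON `O × univ`**: for a window chart `c` with `Sfine` measurable, the map
`(U, x) ↦ ∫⁻ 1_{Sfine ∩ tube_r(x)}(c.Φ(U,z))·c.jac(U,z) dU_K(z)` is l.s.c. on `O ×ˢ univ` (§1 on §4's a.e.-leafwise l.s.c.; the parameter space is metrisable).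
[cite: Balaban1987RG1, (0.13) p.254 (bookkeeping); Balaban1985Averaging, (10) p.19 and Prop. 1 p.22] -/
theorem lowerSemicontinuousOn_tubeCharge (c : WindowChart F hJK Sfine O) (hS : MeasurableSet Sfine) (r : ℝ) :
    LowerSemicontinuousOn (fun p : GaugeField (F.P J) 0 (Matrix.specialUnitaryGroup (Fin 2) ℂ) × GaugeField (F.P K) 0 (Matrix.specialUnitaryGroup (Fin 2) ℂ) =>
      ∫⁻ z, (Sfine ∩ {V : GaugeField (F.P K) 0 (Matrix.specialUnitaryGroup (Fin 2) ℂ) | ∀ b : PBond (F.P K) 0, dist1 ((p.2 b)⁻¹ * V b) < r}).indicator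
            (fun _ => (1 : ℝ≥0∞)) (c.Φ (p.1, z)) * (c.jac (p.1, z) : ℝ≥0∞) ∂(fieldMeasure (F.P K) 0 (Matrix.specialUnitaryGroup (Fin 2) ℂ)))
      (O ×ˢ Set.univ) := by
  refine lowerSemicontinuousOn_lintegral (fun p => (measurable_tubeIntegrand F hJK c hS r p).aemeasurable) ?_
  rintro ⟨U₀, x₀⟩ ⟨hU₀, -⟩
  exact ae_lowerSemicontinuousAt_tubeIntegrand F hJK c hU₀ x₀ r

end Chart

/-! ## §5 The floor: ONE `q > 0` on a compact admissible pair set where every tube is charged; px8 g14's `hfib` letter -/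

section FloorChart

variable (F : T3Family) {J K : ℕ} (hJK : J ≤ K)
  {Sfine : Set (GaugeField (F.P K) 0 (Matrix.specialUnitaryGroup (Fin 2) ℂ))}
  {O : Set (GaugeField (F.P J) 0 (Matrix.specialUnitaryGroup (Fin 2) ℂ))}

/-- The chart's fibre mass is at most its Jacobian bound (Haar is a probability measure). [folklore] -/
theorem lintegral_jac_le_bound (c : WindowChart F hJK Sfine O) (U : GaugeField (F.P J) 0 (Matrix.specialUnitaryGroup (Fin 2) ℂ)) :
    ∫⁻ z, (c.jac (U, z) : ℝ≥0∞) ∂(fieldMeasure (F.P K) 0 (Matrix.specialUnitaryGroup (Fin 2) ℂ)) ≤ (c.bound : ℝ≥0∞) := by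
  calc ∫⁻ z, (c.jac (U, z) : ℝ≥0∞) ∂(fieldMeasure (F.P K) 0 (Matrix.specialUnitaryGroup (Fin 2) ℂ))
      ≤ ∫⁻ _z, (c.bound : ℝ≥0∞) ∂(fieldMeasure (F.P K) 0 (Matrix.specialUnitaryGroup (Fin 2) ℂ)) :=
        lintegral_mono fun z => ENNReal.coe_le_coe.mpr (c.jac_le (U, z))
    _ = (c.bound : ℝ≥0∞) := by rw [lintegral_const, measure_univ, mul_one]

/-- ★★★ **ONE FLOOR ON A COMPACT ADMISSIBLE PAIR SET.**  Window chart `c`, `Sfine` measurable, radius `r`, and a COMPACT set `P` of pairs (datum `U ∈ O`, centre `x`)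
on which every tube is charged: `hpos : ∀ (U, x) ∈ P, 0 < ∫⁻ 1_{Sfine ∩ tube_r(x)}(c.Φ(U,z))·c.jac(U,z) dU_K(z)`.  Then ONE real `q > 0` serves every pair of `P`:
`ofReal q·∫⁻ c.jac(U,z) dU_K(z) ≤ ∫⁻ 1_{tube_r(x)}(c.Φ(U,z))·c.jac(U,z) dU_K(z)` (l.s.c. §4 + compactness §2; `∫⁻ jac ≤ c.bound`; `q := min(m,1)∕(c.bound + 1)`).
The pointwise charge `hpos` ([Balaban1985Averaging] Prop. 1 territory) is the HYPOTHESIS — NOT proved here.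
[cite: Balaban1985Averaging, (10) p.19 and Prop. 1 p.22; Balaban1987RG1, (0.13) p.254 and (2.10) p.267] -/
theorem exists_floor_tubeCharge_of_pos (c : WindowChart F hJK Sfine O) (hS : MeasurableSet Sfine) (r : ℝ)
    {P : Set (GaugeField (F.P J) 0 (Matrix.specialUnitaryGroup (Fin 2) ℂ) × GaugeField (F.P K) 0 (Matrix.specialUnitaryGroup (Fin 2) ℂ))}
    (hP : IsCompact P) (hPO : P ⊆ O ×ˢ Set.univ)
    (hpos : ∀ p ∈ P, 0 < ∫⁻ z, (Sfine ∩ {V : GaugeField (F.P K) 0 (Matrix.specialUnitaryGroup (Fin 2) ℂ) | ∀ b : PBond (F.P K) 0, dist1 ((p.2 b)⁻¹ * V b) < r}).indicator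
            (fun _ => (1 : ℝ≥0∞)) (c.Φ (p.1, z)) * (c.jac (p.1, z) : ℝ≥0∞) ∂(fieldMeasure (F.P K) 0 (Matrix.specialUnitaryGroup (Fin 2) ℂ))) :
    ∃ q : ℝ, 0 < q ∧ ∀ p ∈ P,
      ENNReal.ofReal q * ∫⁻ z, (c.jac (p.1, z) : ℝ≥0∞) ∂(fieldMeasure (F.P K) 0 (Matrix.specialUnitaryGroup (Fin 2) ℂ)) ≤
        ∫⁻ z, {V : GaugeField (F.P K) 0 (Matrix.specialUnitaryGroup (Fin 2) ℂ) | ∀ b : PBond (F.P K) 0, dist1 ((p.2 b)⁻¹ * V b) < r}.indicator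
            (fun _ => (1 : ℝ≥0∞)) (c.Φ (p.1, z)) * (c.jac (p.1, z) : ℝ≥0∞) ∂(fieldMeasure (F.P K) 0 (Matrix.specialUnitaryGroup (Fin 2) ℂ)) := by
  obtain ⟨m, hm, hle⟩ := exists_pos_le_of_lowerSemicontinuousOn hP ((lowerSemicontinuousOn_tubeCharge F hJK c hS r).mono hPO) hpos
  have hfin : min m 1 ≠ ∞ := ne_top_of_le_ne_top ENNReal.one_ne_top (min_le_right _ _)
  have hpos' : 0 < min m 1 := lt_min hm one_pos
  have hb1 : (0 : ℝ) < (c.bound : ℝ) + 1 := by positivity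
  refine ⟨(min m 1).toReal / ((c.bound : ℝ) + 1), div_pos (ENNReal.toReal_pos hpos'.ne' hfin) hb1, fun p hp => ?_⟩
  -- `ofReal q * ∫⁻ jac ≤ ofReal q * bound ≤ min m 1 ≤ m ≤ G p ≤ RHS`
  have hq : ENNReal.ofReal ((min m 1).toReal / ((c.bound : ℝ) + 1)) * (c.bound : ℝ≥0∞) ≤ min m 1 := by
    have hcb : (c.bound : ℝ≥0∞) = ENNReal.ofReal (c.bound : ℝ) := by rw [ENNReal.ofReal_coe_nnreal]
    rw [hcb, ← ENNReal.ofReal_mul (div_nonneg ENNReal.toReal_nonneg hb1.le)]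
    calc ENNReal.ofReal ((min m 1).toReal / ((c.bound : ℝ) + 1) * (c.bound : ℝ))
        ≤ ENNReal.ofReal ((min m 1).toReal / ((c.bound : ℝ) + 1) * ((c.bound : ℝ) + 1)) := by
          gcongr
          linarith
      _ = ENNReal.ofReal ((min m 1).toReal) := by rw [div_mul_cancel₀ _ hb1.ne']
      _ = min m 1 := ENNReal.ofReal_toReal hfin
  have hmono : ∫⁻ z, (Sfine ∩ {V : GaugeField (F.P K) 0 (Matrix.specialUnitaryGroup (Fin 2) ℂ) | ∀ b : PBond (F.P K) 0, dist1 ((p.2 b)⁻¹ * V b) < r}).indicator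
            (fun _ => (1 : ℝ≥0∞)) (c.Φ (p.1, z)) * (c.jac (p.1, z) : ℝ≥0∞) ∂(fieldMeasure (F.P K) 0 (Matrix.specialUnitaryGroup (Fin 2) ℂ)) ≤
      ∫⁻ z, {V : GaugeField (F.P K) 0 (Matrix.specialUnitaryGroup (Fin 2) ℂ) | ∀ b : PBond (F.P K) 0, dist1 ((p.2 b)⁻¹ * V b) < r}.indicator
            (fun _ => (1 : ℝ≥0∞)) (c.Φ (p.1, z)) * (c.jac (p.1, z) : ℝ≥0∞) ∂(fieldMeasure (F.P K) 0 (Matrix.specialUnitaryGroup (Fin 2) ℂ)) :=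
    lintegral_mono fun z => mul_le_mul' (Set.indicator_le_indicator_of_subset Set.inter_subset_right (fun _ => zero_le) _) le_rfl
  calc ENNReal.ofReal ((min m 1).toReal / ((c.bound : ℝ) + 1)) * ∫⁻ z, (c.jac (p.1, z) : ℝ≥0∞) ∂(fieldMeasure (F.P K) 0 (Matrix.specialUnitaryGroup (Fin 2) ℂ))
      ≤ ENNReal.ofReal ((min m 1).toReal / ((c.bound : ℝ) + 1)) * (c.bound : ℝ≥0∞) := mul_le_mul' le_rfl (lintegral_jac_le_bound F hJK c p.1)
    _ ≤ min m 1 := hq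
    _ ≤ m := min_le_left _ _
    _ ≤ _ := hle p hp
    _ ≤ _ := hmono

/-- ★★★ **px8 g14's `hfib` LETTER FROM A POINTWISE CHARGE ON A COMPACT ADMISSIBLE PAIR SET.**  Same data; a section `σ` (ANY function) and a set `W` with
`(U, σ U) ∈ P` for every `U ∈ O ∩ W`.  Then the fibrewise tube letter of ✓`…HaarTubeOneStep.haar_preimage_inter_target_of_windowChart` ∕ `haarTube_oneStep_of_windowChart`
holds — for `dU_J`-a.e. (indeed every) `U ∈ O ∩ W`: `ofReal q·∫⁻ c.jac(U,z) dU_K(z) ≤ ∫⁻ 1_{tube_r(σ U)}(c.Φ(U,z))·c.jac(U,z) dU_K(z)` — with ONE `q > 0`.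
[cite: Balaban1985Averaging, (10) p.19 and Prop. 1 p.22; Balaban1987RG1, (2.10) p.267] -/
theorem hfib_of_pos (c : WindowChart F hJK Sfine O) (hS : MeasurableSet Sfine) (r : ℝ)
    {P : Set (GaugeField (F.P J) 0 (Matrix.specialUnitaryGroup (Fin 2) ℂ) × GaugeField (F.P K) 0 (Matrix.specialUnitaryGroup (Fin 2) ℂ))}
    (hP : IsCompact P) (hPO : P ⊆ O ×ˢ Set.univ)
    (hpos : ∀ p ∈ P, 0 < ∫⁻ z, (Sfine ∩ {V : GaugeField (F.P K) 0 (Matrix.specialUnitaryGroup (Fin 2) ℂ) | ∀ b : PBond (F.P K) 0, dist1 ((p.2 b)⁻¹ * V b) < r}).indicator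
            (fun _ => (1 : ℝ≥0∞)) (c.Φ (p.1, z)) * (c.jac (p.1, z) : ℝ≥0∞) ∂(fieldMeasure (F.P K) 0 (Matrix.specialUnitaryGroup (Fin 2) ℂ)))
    (σ : GaugeField (F.P J) 0 (Matrix.specialUnitaryGroup (Fin 2) ℂ) → GaugeField (F.P K) 0 (Matrix.specialUnitaryGroup (Fin 2) ℂ))
    (W : Set (GaugeField (F.P J) 0 (Matrix.specialUnitaryGroup (Fin 2) ℂ))) (hσ : ∀ U ∈ O ∩ W, (U, σ U) ∈ P) :
    ∃ q : ℝ, 0 < q ∧ ∀ᵐ U ∂(fieldMeasure (F.P J) 0 (Matrix.specialUnitaryGroup (Fin 2) ℂ)), U ∈ O ∩ W →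
      ENNReal.ofReal q * ∫⁻ z, (c.jac (U, z) : ℝ≥0∞) ∂(fieldMeasure (F.P K) 0 (Matrix.specialUnitaryGroup (Fin 2) ℂ)) ≤
        ∫⁻ z, {V : GaugeField (F.P K) 0 (Matrix.specialUnitaryGroup (Fin 2) ℂ) |
            ∀ b : PBond (F.P K) 0, dist1 ((σ U b)⁻¹ * V b) < r}.indicator (fun _ => (1 : ℝ≥0∞)) (c.Φ (U, z)) *
          (c.jac (U, z) : ℝ≥0∞) ∂(fieldMeasure (F.P K) 0 (Matrix.specialUnitaryGroup (Fin 2) ℂ)) := by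
  obtain ⟨q, hq, h⟩ := exists_floor_tubeCharge_of_pos F hJK c hS r hP hPO hpos
  exact ⟨q, hq, Filter.Eventually.of_forall fun U hU => h (U, σ U) (hσ U hU)⟩

end FloorChart

/-! ## §6 (v1.1) The kinematic feeders of `hfib_of_pos` and the point-charge door -/

section Feeders

variable (F : T3Family) {J K : ℕ} (hJK : J ≤ K)
  {Sfine : Set (GaugeField (F.P K) 0 (Matrix.specialUnitaryGroup (Fin 2) ℂ))}
  {O : Set (GaugeField (F.P J) 0 (Matrix.specialUnitaryGroup (Fin 2) ℂ))}

/-- **POSITIVE LIVE MASS ⟹ POSITIVE TUBE CHARGE**: if the chart's live set `{z | c.jac (U,z) ≠ 0 ∧ c.Φ (U,z) ∈ Sfine ∩ tube_r(x)}` over a datum `U` has positive Haar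
mass, then the tube charge `∫⁻ 1_{Sfine ∩ tube_r(x)}(c.Φ(U,z))·c.jac(U,z) dU_K(z)` is positive (that set is the support of the integrand; ✓`lintegral_pos_iff_support`).
This is the shape in which an explicit chart's local charge row (a neighbourhood of a charted fibre point is charged, Haar has full support) feeds `hpos`.
[cite: Balaban1985Averaging, (10) p.19 and Prop. 1 p.22] -/
theorem pos_tubeCharge_of_measure_pos (c : WindowChart F hJK Sfine O) (hS : MeasurableSet Sfine) (r : ℝ)
    (p : GaugeField (F.P J) 0 (Matrix.specialUnitaryGroup (Fin 2) ℂ) × GaugeField (F.P K) 0 (Matrix.specialUnitaryGroup (Fin 2) ℂ))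
    (h : 0 < fieldMeasure (F.P K) 0 (Matrix.specialUnitaryGroup (Fin 2) ℂ)
      {z | c.jac (p.1, z) ≠ 0 ∧ c.Φ (p.1, z) ∈ Sfine ∩ {V : GaugeField (F.P K) 0 (Matrix.specialUnitaryGroup (Fin 2) ℂ) |
        ∀ b : PBond (F.P K) 0, dist1 ((p.2 b)⁻¹ * V b) < r}}) :
    0 < ∫⁻ z, (Sfine ∩ {V : GaugeField (F.P K) 0 (Matrix.specialUnitaryGroup (Fin 2) ℂ) | ∀ b : PBond (F.P K) 0, dist1 ((p.2 b)⁻¹ * V b) < r}).indicator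
        (fun _ => (1 : ℝ≥0∞)) (c.Φ (p.1, z)) * (c.jac (p.1, z) : ℝ≥0∞) ∂(fieldMeasure (F.P K) 0 (Matrix.specialUnitaryGroup (Fin 2) ℂ)) := by
  rw [lintegral_pos_iff_support (measurable_tubeIntegrand F hJK c hS r p)]
  refine h.trans_le (measure_mono ?_)
  rintro z ⟨hj, hΦ⟩
  rw [Function.mem_support, Set.indicator_of_mem hΦ, one_mul]
  exact ENNReal.coe_ne_zero.mpr hj

/-- **The admissible pair set of a compact fibre-point class is compact**: if `C` is compact and `D` is continuous ON `C`, then `(fun x => (D x, x)) '' C` is compact.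
[folklore] -/
theorem isCompact_graph_image {X Y : Type*} [TopologicalSpace X] [TopologicalSpace Y] {C : Set X} (hC : IsCompact C) {D : X → Y}
    (hD : ContinuousOn D C) : IsCompact ((fun x => (D x, x)) '' C) :=
  hC.image_of_continuousOn (hD.prodMk continuousOn_id)

/-- **… lies over `O`** when `D '' C ⊆ O`. [folklore] -/
theorem graph_image_subset_prod {X Y : Type*} {C : Set X} {D : X → Y} {O : Set Y} (hDO : ∀ x ∈ C, D x ∈ O) :
    (fun x => (D x, x)) '' C ⊆ O ×ˢ (Set.univ : Set X) := by
  rintro _ ⟨x, hx, rfl⟩; exact ⟨hDO x hx, Set.mem_univ _⟩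

/-- **… and contains `(U, y)` for every `y ∈ C` with `D y = U`** (the section values). [folklore] -/
theorem mem_graph_image {X Y : Type*} {C : Set X} {D : X → Y} {U : Y} {y : X} (hy : y ∈ C) (hDy : D y = U) :
    (U, y) ∈ (fun x => (D x, x)) '' C := ⟨y, hy, by simp only [hDy]⟩

/-- ★★★ **px8 g14's `hfib` LETTER FROM A POINT CHARGE ON A COMPACT FIBRE-POINT CLASS.**  Window chart `c` (any `J ≤ K`), `Sfine` measurable, radius `r`; a COMPACT class
`C` of fine fields (e.g. the strict-small fields over a closed neighbourhood of the datum) on which `D = descendTo F ℰp J K hJK` is continuous, with `D '' C ⊆ O`; the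
POINT CHARGE: over every `x ∈ C` the live set `{z | c.jac (D x, z) ≠ 0 ∧ c.Φ (D x, z) ∈ Sfine ∩ tube_r(x)}` has positive Haar mass; a section `σ` (ANY function) with
`σ U ∈ C`, `D (σ U) = U` on `O ∩ W`.  THEN ONE `q > 0` gives, for `dU_J`-a.e. `U ∈ O ∩ W`, `ofReal q·∫⁻ c.jac(U,z) ≤ ∫⁻ 1_{tube_r(σ U)}(c.Φ(U,z))·c.jac(U,z)` — the `hfib`
of ✓`…HaarTubeOneStep.haarTube_oneStep_of_windowChart` token-for-token (§5 on the pair set `(D, id) '' C`).  The point charge ([Balaban1985Averaging] Prop. 1) is the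
HYPOTHESIS — NOT proved here. [cite: Balaban1985Averaging, (10) p.19 and Prop. 1 p.22; Balaban1987RG1, (0.13) p.254 and (2.10) p.267] -/
theorem hfib_of_pointCharge (c : WindowChart F hJK Sfine O) (hS : MeasurableSet Sfine) (r : ℝ)
    {C : Set (GaugeField (F.P K) 0 (Matrix.specialUnitaryGroup (Fin 2) ℂ))} (hC : IsCompact C)
    (hD : ContinuousOn (descendTo F ℰp J K hJK) C) (hDO : ∀ x ∈ C, descendTo F ℰp J K hJK x ∈ O)
    (hcharge : ∀ x ∈ C, 0 < fieldMeasure (F.P K) 0 (Matrix.specialUnitaryGroup (Fin 2) ℂ)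
      {z | c.jac (descendTo F ℰp J K hJK x, z) ≠ 0 ∧ c.Φ (descendTo F ℰp J K hJK x, z) ∈ Sfine ∩
        {V : GaugeField (F.P K) 0 (Matrix.specialUnitaryGroup (Fin 2) ℂ) | ∀ b : PBond (F.P K) 0, dist1 ((x b)⁻¹ * V b) < r}})
    (σ : GaugeField (F.P J) 0 (Matrix.specialUnitaryGroup (Fin 2) ℂ) → GaugeField (F.P K) 0 (Matrix.specialUnitaryGroup (Fin 2) ℂ))
    (W : Set (GaugeField (F.P J) 0 (Matrix.specialUnitaryGroup (Fin 2) ℂ)))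
    (hσC : ∀ U ∈ O ∩ W, σ U ∈ C) (hσD : ∀ U ∈ O ∩ W, descendTo F ℰp J K hJK (σ U) = U) :
    ∃ q : ℝ, 0 < q ∧ ∀ᵐ U ∂(fieldMeasure (F.P J) 0 (Matrix.specialUnitaryGroup (Fin 2) ℂ)), U ∈ O ∩ W →
      ENNReal.ofReal q * ∫⁻ z, (c.jac (U, z) : ℝ≥0∞) ∂(fieldMeasure (F.P K) 0 (Matrix.specialUnitaryGroup (Fin 2) ℂ)) ≤
        ∫⁻ z, {V : GaugeField (F.P K) 0 (Matrix.specialUnitaryGroup (Fin 2) ℂ) |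
            ∀ b : PBond (F.P K) 0, dist1 ((σ U b)⁻¹ * V b) < r}.indicator (fun _ => (1 : ℝ≥0∞)) (c.Φ (U, z)) *
          (c.jac (U, z) : ℝ≥0∞) ∂(fieldMeasure (F.P K) 0 (Matrix.specialUnitaryGroup (Fin 2) ℂ)) := by
  refine hfib_of_pos F hJK c hS r (isCompact_graph_image hC hD) (graph_image_subset_prod hDO) ?_ σ W
    (fun U hU => mem_graph_image (hσC U hU) (hσD U hU))
  rintro _ ⟨x, hx, rfl⟩
  exact pos_tubeCharge_of_measure_pos F hJK c hS r (descendTo F ℰp J K hJK x, x) (hcharge x hx)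

end Feeders

end Summit.QuantumFields.YangMills.Theorems.FluctuationComparisonRegPrIntLHaarTubeLscFloor

end
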